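import Summits.BirchSwinnertonDyer.BirchSwinnertonDyer.Theorems.ClassRecordThreeEulerHalvesAtThreeEichlerShimuraTorsionCountM
import Literature.Geometry.Kaehler.RiemannSurfaceIntermediateOrbitSurfaces
import Literature.Topology.CoveringSpaces.OrbitQuotientCovering
import HarnessLib

/-!
# Crux NUM `CartanOnePlaceDegreeLawAtThree` (item 24801), line `petarea` rev 6, cite conjunct 4 (torsion-null lifting at division algebras):
# THE DOWNSTAIRS HALF OF THE KERNEL-COVER TOWER — `M/H → M/G` is a quotient covering map for `G ⧸ H` when the `G`-stabilisers lie in `H`,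
# and the ASSEMBLY «finite holomorphic quotient datum for `ι(O¹)` ⟹ the torsion-null cochain `ψ` lifts to `ℤ`»

Seat `bsd-stepL-tam3-p1` g32 (LEAD of crux 24801; `--supports stmt-BirchSwinnertonDyer-24801 --as helper`). The keyed line `Lines/petarea.lean` rev 6 has ONE
pure-cite stub `stub_printInputsFive`; its conjunct 4 is the clause `htors` of `EichlerShimuraLevelK.parabolicCochain_modLift_of_torsLift`: at a quaternion
DIVISION algebra `B/ℚ`, every additive `ψ : ι(O¹) → ℤ/n` vanishing on the elements of finite order is the reduction of an additive `u : ι(O¹) → ℤ`.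
bsd-idea-10 g25's part M (`EichlerShimuraLevelM.torsLift_of_tower`) reduced this to a KERNEL-COVER TOWER `ℍ → Y → X` (`X` a compact Riemann surface,
`Y → X` a quotient covering for a group `A`, an equivariant `q : ℍ → Y`, a character of `A` inducing `ψ`), and part N proved its group-theoretic bricks.
This file proves the two remaining GENERAL pieces, leaving only the construction of the upstairs Riemann surface `M = Γ'∖ℍ` with its finite holomorphic
group action (brick (T-b), bsd-idea-10's lane):

* §1 (pure topology ∕ group theory; any `G` acting on any `M`, `H ⊴ G`): the factor map `f_{H,G} : M/H → M/G` of the tree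
  (`RiemannSurface.OrbitSurface.factor`, Khovanskii §2.2.3) is the orbit map of the action of `G ⧸ H` on `M/H`
  (`Literature.Topology.CoveringSpaces.OrbitQuotient.mulAction`: `(gH)·[m] = [g·m]`) — `factor_eq_factor_iff_mem_orbit`; that action is FREE as soon as every
  stabiliser `G_m` lies in `H` — `isCancelSMul_orbitSurface_of_stabilizer_le`; `f_{H,G}` is a topological quotient map — `isQuotientMap_factor`; hence, for `G`
  finite and `M` locally compact Hausdorff, **`f_{H,G}` is a quotient covering map with deck group `G ⧸ H`** — `isQuotientCoveringMap_factor` (Mathlib's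
  `IsQuotientMap.isQuotientCoveringMap_of_properlyDiscontinuousSMul`; Hatcher Prop. 1.40, Khovanskii §2.2.3 item 4 in the unramified case).
* §2 (the family `Γ = ι(O¹) = normOneUnits ι hO`): **`torsLift_of_holomorphicQuotientDatum`** — if `Γ` maps onto a FINITE group `G` acting holomorphically
  and effectively on a compact connected Riemann surface `M`, equivariantly along a continuous surjection `p : ℍ → M`, and `ψ` vanishes on every `γ` for
  which `σ γ` fixes a point of `p(ℍ) = M`, then `ψ` lifts: with `H = ker ψ̄ ⊴ G` (`ψ̄` the descent of `ψ` to `G`), the tower is `X = M/G`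
  (a compact Riemann surface by the tree's `RiemannSurface.OrbitSurface.instIsManifold`, Miranda III.3.4), `Y = M/H`, `A = G ⧸ H`, `π = f_{H,G}` (§1),
  `q = π_H ∘ p`, `χ = ψ̄ mod H`; then part M. `torsLift_of_holomorphicQuotientData` is the all-`ψ` form (conjunct 4 of `stub_printInputsFive` VERBATIM as
  conclusion). The intended datum (brick (T-b)): `M = Γ'∖ℍ` for part N's torsion-free normal cocompact level `Γ' ≤ ker ψ`
  (`EichlerShimuraLevelN.exists_torsionFree_level_subgroup_le_ker`), `G = Γ ∕ (kernel of Γ on M)`, `p` the projection; the vanishing clause is part N's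
  `EichlerShimuraLevelN.eq_zero_of_smul_eq_smul`.

Theorems only: no definition, no instance (the `G ⧸ H`-action on `M/H` is the tree's `OrbitQuotient.mulAction`, named explicitly in each statement),
no notation, no named fact, no `sorry`. Nothing about NUM, (M), (KTYPE), (PET) or any curve is proved; no summit statement is proved; BSD is proved for no curve.

## References
* A. Hatcher, *Algebraic Topology*, CUP (2002), §1.3 Prop. 1.40 p. 72 (a free properly discontinuous action gives a normal covering `Y → Y/A` with
  deck group `A`), Exercise 24. [HatcherAT2002]
* A. Khovanskii, *Galois Theory, Coverings, and Riemann Surfaces*, Springer (2013), §2.2.3, statements 1.–4. after Thm. 2.2.11 pp. 59–61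
  (`f_{G₁,G₂} : M_{G₁} → M_{G₂}`; for `G₁ ⊴ G₂` it is normal with deck group `G₂/G₁`). [Khovanskii2013]
* R. Miranda, *Algebraic Curves and Riemann Surfaces*, GSM 5 (1995), Ch. III Thm. 3.4 (`X/G` is a Riemann surface). [Miranda1995]
* G. Shimura, *Introduction to the Arithmetic Theory of Automorphic Functions* (1971), §1.5, §8.2 (8.2.6) p. 232, §9.2 p. 246. [ShimuraIATAF1971]
-/

set_option linter.dupNamespace false
set_option autoImplicit false

noncomputable section

open scoped Manifold ContDiff Topology MatrixGroups
open Function Set MulAction Topology Multiplicative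

namespace Summit.BirchSwinnertonDyer.BirchSwinnertonDyer.Theorems.EichlerShimuraTower

open Literature.Geometry.Kaehler Literature.Geometry.Kaehler.RiemannSurface Literature.Topology.CoveringSpaces
open Literature.NumberTheory.Automorphic

/-! ## §1 `M/H → M/G` is the quotient covering map of `G ⧸ H` acting on `M/H` (when `G`-stabilisers lie in `H`) -/

section Factor

variable {G M : Type*} [Group G] [MulAction G M] (H : Subgroup G) [H.Normal]

/-- **The fibres of `f_{H,G} : M/H → M/G` are the `G ⧸ H`-orbits** (for the action `(gH)·[m] = [g·m]` of the tree's `OrbitQuotient.mulAction`).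
[cite: Khovanskii2013, §2.2.3 (statements following Theorem 2.2.11, p. 61)] -/
theorem factor_eq_factor_iff_mem_orbit {y₁ y₂ : OrbitSurface H M} :
    letI : MulAction (G ⧸ H) (OrbitSurface H M) := OrbitQuotient.mulAction H
    OrbitSurface.factor H y₁ = OrbitSurface.factor H y₂ ↔ y₁ ∈ MulAction.orbit (G ⧸ H) y₂ := by
  letI : MulAction (G ⧸ H) (OrbitSurface H M) := OrbitQuotient.mulAction H
  induction y₁ using OrbitSurface.ind with
  | h x₁ =>
  induction y₂ using OrbitSurface.ind with
  | h x₂ =>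
    rw [OrbitSurface.factor_mk_eq_factor_mk_iff, MulAction.mem_orbit_iff]
    constructor
    · rintro ⟨g, hg⟩
      refine ⟨(QuotientGroup.mk g⁻¹ : G ⧸ H), ?_⟩
      change (OrbitSurface.mk H (g⁻¹ • x₂) : OrbitSurface H M) = OrbitSurface.mk H x₁
      rw [← hg, inv_smul_smul]
    · rintro ⟨a, ha⟩
      induction a using QuotientGroup.induction_on with
      | H g =>
        change (OrbitSurface.mk H (g • x₂) : OrbitSurface H M) = OrbitSurface.mk H x₁ at ha
        obtain ⟨h, hh⟩ := OrbitSurface.mk_eq_mk_iff.mp ha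
        refine ⟨((h : G) * g)⁻¹, ?_⟩
        rw [← hh, Subgroup.smul_def, smul_smul, smul_smul, mul_assoc, inv_mul_cancel, one_smul]

/-- **`G ⧸ H` acts FREELY on `M/H` when every stabiliser `G_m` lies in `H`** (`gH·[m] = [m]` means `h·g ∈ G_m` for some `h ∈ H`).
[cite: HatcherAT2002, §1.3 Prop. 1.40 p. 72] -/
theorem isCancelSMul_orbitSurface_of_stabilizer_le (hstab : ∀ m : M, MulAction.stabilizer G m ≤ H) :
    letI : MulAction (G ⧸ H) (OrbitSurface H M) := OrbitQuotient.mulAction H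
    IsCancelSMul (G ⧸ H) (OrbitSurface H M) := by
  letI : MulAction (G ⧸ H) (OrbitSurface H M) := OrbitQuotient.mulAction H
  refine isCancelSMul_iff_eq_one_of_smul_eq.mpr fun a y hay => ?_
  induction a using QuotientGroup.induction_on with
  | H g =>
  induction y using OrbitSurface.ind with
  | h x =>
    change (OrbitSurface.mk H (g • x) : OrbitSurface H M) = OrbitSurface.mk H x at hay
    obtain ⟨h, hh⟩ := OrbitSurface.mk_eq_mk_iff.mp hay
    have hmem : (h : G) * g ∈ MulAction.stabilizer G x := by
      rw [MulAction.mem_stabilizer_iff, mul_smul]; exact hh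
    have hg : g ∈ H := by
      have := hstab x hmem
      simpa using H.mul_mem (H.inv_mem h.2) this
    exact (QuotientGroup.eq_one_iff g).mpr hg

/-- `π_H` is equivariant along `G → G ⧸ H`: `π_H (g • m) = (gH) • π_H m`. [cite: Khovanskii2013, §2.2.3 (p. 61)] -/
theorem mk_smul_eq_quotient_smul_mk (g : G) (m : M) :
    letI : MulAction (G ⧸ H) (OrbitSurface H M) := OrbitQuotient.mulAction H
    (OrbitSurface.mk H (g • m) : OrbitSurface H M) = (QuotientGroup.mk g : G ⧸ H) • OrbitSurface.mk H m :=
  rfl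

variable [TopologicalSpace M]

omit [H.Normal] in
/-- **`f_{H,G}` is a topological quotient map** (`π_G = f_{H,G} ∘ π_H` with `π_G` a quotient map and `π_H`, `f_{H,G}` continuous).
[cite: Khovanskii2013, §2.2.3 (statement 3 following Theorem 2.2.11, p. 61)] -/
theorem isQuotientMap_factor [ContinuousConstSMul G M] :
    IsQuotientMap (OrbitSurface.factor H : OrbitSurface H M → OrbitSurface G M) := by
  refine IsQuotientMap.of_comp OrbitSurface.continuous_mk (OrbitSurface.continuous_factor H) ?_
  rw [OrbitSurface.factor_comp_mk]
  exact OrbitSurface.isOpenQuotientMap_mk.isQuotientMap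

/-- **`f_{H,G} : M/H → M/G` IS A QUOTIENT COVERING MAP WITH DECK GROUP `G ⧸ H`** when `G` is finite, `M` is locally compact Hausdorff, and every stabiliser
`G_m` lies in `H` (the unramified case of Khovanskii's item 4; Hatcher Prop. 1.40 for the free properly discontinuous action of `G ⧸ H` on `M/H`).
[cite: HatcherAT2002, §1.3 Prop. 1.40 p. 72] [cite: Khovanskii2013, §2.2.3 (statement 4 following Theorem 2.2.11, p. 61)] -/
theorem isQuotientCoveringMap_factor [T2Space M] [LocallyCompactSpace M] [Finite G] [ContinuousConstSMul G M]
    (hstab : ∀ m : M, MulAction.stabilizer G m ≤ H) :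
    letI : MulAction (G ⧸ H) (OrbitSurface H M) := OrbitQuotient.mulAction H
    IsQuotientCoveringMap (OrbitSurface.factor H : OrbitSurface H M → OrbitSurface G M) (G ⧸ H) := by
  letI : MulAction (G ⧸ H) (OrbitSurface H M) := OrbitQuotient.mulAction H
  haveI : ContinuousConstSMul (G ⧸ H) (OrbitSurface H M) := OrbitQuotient.continuousConstSMul H
  haveI : IsCancelSMul (G ⧸ H) (OrbitSurface H M) := isCancelSMul_orbitSurface_of_stabilizer_le H hstab
  haveI : T2Space (OrbitSurface H M) :=
    inferInstanceAs (T2Space (Quotient (MulAction.orbitRel H M)))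
  haveI : LocallyCompactSpace (OrbitSurface H M) := OrbitQuotient.locallyCompactSpace H
  exact (isQuotientMap_factor H).isQuotientCoveringMap_of_properlyDiscontinuousSMul
    (fun {y₁ y₂} => factor_eq_factor_iff_mem_orbit H (y₁ := y₁) (y₂ := y₂))

/-- The Riemann-surface case: `M` a Riemann surface (locally compact as a charted space over `ℂ`). [cite: Khovanskii2013, §2.2.3 (statement 4 following Theorem 2.2.11, p. 61)] -/
theorem isQuotientCoveringMap_factor_of_chartedSpace [ChartedSpace ℂ M] [T2Space M] [Finite G] [ContinuousConstSMul G M]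
    (hstab : ∀ m : M, MulAction.stabilizer G m ≤ H) :
    letI : MulAction (G ⧸ H) (OrbitSurface H M) := OrbitQuotient.mulAction H
    IsQuotientCoveringMap (OrbitSurface.factor H : OrbitSurface H M → OrbitSurface G M) (G ⧸ H) := by
  haveI : LocallyCompactSpace M := ChartedSpace.locallyCompactSpace ℂ M
  exact isQuotientCoveringMap_factor H hstab

end Factor

/-! ## §2 The assembly for `Γ = ι(O¹)`: a finite holomorphic quotient datum gives the integral lift of `ψ` -/

/-- **TORSION-NULL LIFTING FROM A FINITE HOLOMORPHIC QUOTIENT DATUM.** Let `Γ = ι(O¹)` and let `ψ : Γ → ZMod n` be additive. Suppose given a compact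
connected Riemann surface `M`, a finite group `G` acting holomorphically and effectively on `M`, a surjection `σ : Γ ↠ G` and a continuous surjection
`p : ℍ → M` with `p (γ z) = σ(γ) p(z)`, such that `ψ γ = 0` whenever `σ γ` fixes a point of `M`. Then `ψ` is the reduction of an additive `u : Γ → ℤ`.
(Tower for part M: `X = M/G`, `Y = M/ker ψ̄`, `A = G ⧸ ker ψ̄`, `π = f_{ker ψ̄, G}` a quotient covering by §1, `q = π_{ker ψ̄} ∘ p`, `χ = ψ̄`.)
[cite: HatcherAT2002, §1.3 Prop. 1.40 p. 72] [cite: Miranda1995, Chapter III Theorem 3.4] [cite: ShimuraIATAF1971, §8.2 (8.2.6) p. 232 and §9.2 p. 246] -/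
theorem torsLift_of_holomorphicQuotientDatum (B : Type) [Ring B] [Algebra ℚ B] [IsQuaternionAlgebra ℚ B] (O : Submodule ℤ B)
    (hO : Brandt.IsOrder B O) (ι : B →ₐ[ℚ] Matrix (Fin 2) (Fin 2) ℝ) (n : ℕ) (ψ : normOneUnits ι hO → ZMod n)
    (hadd : ∀ γ δ : normOneUnits ι hO, ψ (γ * δ) = ψ γ + ψ δ)
    (datum : ∃ (M : Type) (_ : TopologicalSpace M) (_ : ChartedSpace ℂ M) (_ : IsManifold 𝓘(ℂ, ℂ) ω M)
        (_ : T2Space M) (_ : CompactSpace M) (_ : ConnectedSpace M)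
        (G : Type) (_ : Group G) (_ : Finite G) (_ : MulAction G M) (_ : HolomorphicSMul G M) (_ : FaithfulSMul G M)
        (σ : normOneUnits ι hO →* G) (p : C(UpperHalfPlane, M)),
        Function.Surjective σ ∧ Function.Surjective p ∧
          (∀ (γ : normOneUnits ι hO) (z : UpperHalfPlane), p (γ • z) = σ γ • p z) ∧
          ∀ (γ : normOneUnits ι hO) (z : UpperHalfPlane), σ γ • p z = p z → ψ γ = 0) :
    ∃ u : normOneUnits ι hO → ℤ,
      (∀ γ δ : normOneUnits ι hO, u (γ * δ) = u γ + u δ) ∧ ∀ γ : normOneUnits ι hO, (u γ : ZMod n) = ψ γ := by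
  classical
  obtain ⟨M, _, _, _, _, _, _, G, _, _, _, _, _, σ, p, hσ, hp, hequiv, hfix⟩ := datum
  -- `ψ` as a homomorphism, and its descent `ψG` to `G`
  have hψ1 : ψ 1 = 0 := by have h := hadd 1 1; rw [mul_one] at h; exact left_eq_add.mp h
  let ψh : normOneUnits ι hO →* Multiplicative (ZMod n) :=
    { toFun := fun γ => ofAdd (ψ γ), map_one' := by simp [hψ1], map_mul' := fun γ δ => by simp [hadd, ofAdd_add] }
  have hψh : ∀ γ, ψh γ = ofAdd (ψ γ) := fun γ => rfl
  have hkerσ : σ.ker ≤ ψh.ker := by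
    intro γ hγ
    rw [MonoidHom.mem_ker] at hγ ⊢
    have h0 : ψ γ = 0 := hfix γ UpperHalfPlane.I (by rw [hγ, one_smul])
    rw [hψh, h0, ofAdd_zero]
  let ψG : G →* Multiplicative (ZMod n) :=
    σ.liftOfRightInverse (Function.surjInv hσ) (Function.rightInverse_surjInv hσ) ⟨ψh, hkerσ⟩
  have hψG : ∀ γ, ψG (σ γ) = ofAdd (ψ γ) := fun γ =>
    (σ.liftOfRightInverse_comp_apply (Function.surjInv hσ) (Function.rightInverse_surjInv hσ) ⟨ψh, hkerσ⟩ γ).trans (hψh γ)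
  -- the subgroup `H = ker ψG ⊴ G` contains every stabiliser
  let H : Subgroup G := ψG.ker
  haveI : H.Normal := inferInstance
  have hstab : ∀ m : M, MulAction.stabilizer G m ≤ H := by
    intro m g hg
    obtain ⟨z, rfl⟩ := hp m
    obtain ⟨γ, rfl⟩ := hσ g
    rw [MonoidHom.mem_ker, hψG, hfix γ z (MulAction.mem_stabilizer_iff.mp hg), ofAdd_zero]
  -- the tower
  letI : MulAction (G ⧸ H) (OrbitSurface H M) := OrbitQuotient.mulAction H
  have hπ : IsQuotientCoveringMap (OrbitSurface.factor H : OrbitSurface H M → OrbitSurface G M) (G ⧸ H) :=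
    isQuotientCoveringMap_factor_of_chartedSpace H hstab
  let q : C(UpperHalfPlane, OrbitSurface H M) := (⟨OrbitSurface.mk H, OrbitSurface.continuous_mk⟩ : C(M, OrbitSurface H M)).comp p
  let τ : normOneUnits ι hO → G ⧸ H := fun γ => QuotientGroup.mk (σ γ)
  have hq : ∀ (γ : normOneUnits ι hO) (z : UpperHalfPlane), q (γ • z) = τ γ • q z := by
    intro γ z
    change OrbitSurface.mk H (p (γ • z)) = (QuotientGroup.mk (σ γ) : G ⧸ H) • OrbitSurface.mk H (p z)
    rw [hequiv]; rfl
  let χ : G ⧸ H →* Multiplicative (ZMod n) := QuotientGroup.kerLift ψG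
  have hχ : ∀ γ : normOneUnits ι hO, χ (τ γ) = ofAdd (ψ γ) := fun γ => by
    change QuotientGroup.kerLift ψG (QuotientGroup.mk (σ γ)) = _
    rw [QuotientGroup.kerLift_mk, hψG]
  exact EichlerShimuraLevelM.torsLift_of_tower B O hO ι n ψ
    ⟨OrbitSurface G M, inferInstance, inferInstance, inferInstance, inferInstance, inferInstance, inferInstance,
      OrbitSurface H M, inferInstance, G ⧸ H, inferInstance, OrbitQuotient.mulAction H, OrbitSurface.factor H, hπ, q, τ, χ, hq, hχ⟩

/-- **CONJUNCT 4 OF `stub_printInputsFive` (`Lines/petarea.lean` rev 6) FROM FINITE HOLOMORPHIC QUOTIENT DATA** — the hypothesis `htors` of part K's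
`EichlerShimuraLevelK.parabolicCochain_modLift_of_torsLift`, VERBATIM, from one datum per torsion-null additive `ψ` (`n ≠ 0`) at every division `B`
(the vanishing clause of the datum is where torsion-nullity is consumed: part N's `EichlerShimuraLevelN.eq_zero_of_smul_eq_smul`).
[cite: ShimuraIATAF1971, §8.2 (8.2.6) p. 232 and §9.2 p. 246] [cite: HatcherAT2002, §1.3 Prop. 1.40 p. 72] -/
theorem torsLift_of_holomorphicQuotientData
    (hdata : ∀ (B : Type) [Ring B] [Algebra ℚ B] [IsQuaternionAlgebra ℚ B] (O : Submodule ℤ B) (hO : Brandt.IsOrder B O)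
      (ι : B →ₐ[ℚ] Matrix (Fin 2) (Fin 2) ℝ), Function.Injective ι → (∀ x : B, x ≠ 0 → IsUnit x) →
      ∀ (n : ℕ), n ≠ 0 → ∀ ψ : normOneUnits ι hO → ZMod n,
        (∀ γ δ : normOneUnits ι hO, ψ (γ * δ) = ψ γ + ψ δ) →
        (∀ γ : normOneUnits ι hO, IsOfFinOrder γ → ψ γ = 0) →
        ∃ (M : Type) (_ : TopologicalSpace M) (_ : ChartedSpace ℂ M) (_ : IsManifold 𝓘(ℂ, ℂ) ω M)
          (_ : T2Space M) (_ : CompactSpace M) (_ : ConnectedSpace M)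
          (G : Type) (_ : Group G) (_ : Finite G) (_ : MulAction G M) (_ : HolomorphicSMul G M) (_ : FaithfulSMul G M)
          (σ : normOneUnits ι hO →* G) (p : C(UpperHalfPlane, M)),
          Function.Surjective σ ∧ Function.Surjective p ∧
            (∀ (γ : normOneUnits ι hO) (z : UpperHalfPlane), p (γ • z) = σ γ • p z) ∧
            ∀ (γ : normOneUnits ι hO) (z : UpperHalfPlane), σ γ • p z = p z → ψ γ = 0) :
    ∀ (B : Type) [Ring B] [Algebra ℚ B] [IsQuaternionAlgebra ℚ B] (O : Submodule ℤ B) (hO : Brandt.IsOrder B O)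
      (ι : B →ₐ[ℚ] Matrix (Fin 2) (Fin 2) ℝ), Function.Injective ι → (∀ x : B, x ≠ 0 → IsUnit x) →
      ∀ (n : ℕ), n ≠ 0 → ∀ ψ : normOneUnits ι hO → ZMod n,
        (∀ γ δ : normOneUnits ι hO, ψ (γ * δ) = ψ γ + ψ δ) →
        (∀ γ : normOneUnits ι hO, IsOfFinOrder γ → ψ γ = 0) →
        ∃ u : normOneUnits ι hO → ℤ,
          (∀ γ δ : normOneUnits ι hO, u (γ * δ) = u γ + u δ) ∧ ∀ γ : normOneUnits ι hO, (u γ : ZMod n) = ψ γ :=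
  fun B _ _ _ O hO ι hι hdiv n hn ψ hadd htor =>
    torsLift_of_holomorphicQuotientDatum B O hO ι n ψ hadd (hdata B O hO ι hι hdiv n hn ψ hadd htor)

/-- **(SIGᶜ-lift) ITSELF from finite holomorphic quotient data** (via part K). [cite: ShimuraIATAF1971, §8.2 (8.2.6) p. 232] -/
theorem parabolicCochain_modLift_of_holomorphicQuotientData
    (hdata : ∀ (B : Type) [Ring B] [Algebra ℚ B] [IsQuaternionAlgebra ℚ B] (O : Submodule ℤ B) (hO : Brandt.IsOrder B O)
      (ι : B →ₐ[ℚ] Matrix (Fin 2) (Fin 2) ℝ), Function.Injective ι → (∀ x : B, x ≠ 0 → IsUnit x) →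
      ∀ (n : ℕ), n ≠ 0 → ∀ ψ : normOneUnits ι hO → ZMod n,
        (∀ γ δ : normOneUnits ι hO, ψ (γ * δ) = ψ γ + ψ δ) →
        (∀ γ : normOneUnits ι hO, IsOfFinOrder γ → ψ γ = 0) →
        ∃ (M : Type) (_ : TopologicalSpace M) (_ : ChartedSpace ℂ M) (_ : IsManifold 𝓘(ℂ, ℂ) ω M)
          (_ : T2Space M) (_ : CompactSpace M) (_ : ConnectedSpace M)
          (G : Type) (_ : Group G) (_ : Finite G) (_ : MulAction G M) (_ : HolomorphicSMul G M) (_ : FaithfulSMul G M)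
          (σ : normOneUnits ι hO →* G) (p : C(UpperHalfPlane, M)),
          Function.Surjective σ ∧ Function.Surjective p ∧
            (∀ (γ : normOneUnits ι hO) (z : UpperHalfPlane), p (γ • z) = σ γ • p z) ∧
            ∀ (γ : normOneUnits ι hO) (z : UpperHalfPlane), σ γ • p z = p z → ψ γ = 0) :
    parabolicCochain_modLift :=
  EichlerShimuraLevelK.parabolicCochain_modLift_of_torsLift (torsLift_of_holomorphicQuotientData hdata)

end Summit.BirchSwinnertonDyer.BirchSwinnertonDyer.Theorems.EichlerShimuraTower

end
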